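import Summits.AtomisticToContinuum.HydrodynamicLimit.Theses.AntiMazurCoboundaries
import Literature.MathematicalPhysics.KineticTheory.HardSphereEulerProofs
import Literature.MathematicalPhysics.KineticTheory.HardSphereBBGKYLiouvilleFlow
import Literature.Analysis.FluidPDE.HardSphereMomentumConservation

/-!
# Stationarity of the constant-profile local Gibbs law under every hard-sphere flow (helper file 1/7)

`Φ_t ∗ G_N = G_N` (`map_flow_localGibbsLaw_const`, `measurePreserving_flow_localGibbsLaw`): Liouville's theorem
(`HardSphereFlow.measurePreserving`) plus invariance of the canonical density on the conull good set — the density is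
a function of `Σᵢ|vᵢ − u|² = 2E − 2⟪P, u⟫ + (N+1)|u|²`, conserved by `configEnergy_flow` / `configMomentum_flow`.
(This is the content of the support item `HomogeneousInvariance`, stmt-9621, whose by-name proof is attached there as
prover evidence; here it is a helper of a negative lemma.)
refuter-cdisprove-stmt-AtomisticToContinuum-13985-0 (crux BoltzmannGreenKubo, stmt-13985; infrastructure of the Mazur-floor refutation `Negative/OrthMomentum.lean`, see `Cruxes/BoltzmannGreenKubo/Disproof.lean` §1d–§1h).
-/

noncomputable section

namespace Summit.AtomisticToContinuum.HydrodynamicLimit.Theorems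

open MeasureTheory ProbabilityTheory Filter Topology Set
open Literature.Analysis.FluidPDE Literature.MathematicalPhysics.KineticTheory
open Literature.Analysis.UnboundedOperators
open scoped InnerProductSpace

namespace BoltzmannGreenKuboOrthMomentum

/-- The velocity part of the exponent of a constant-profile local Gibbs weight is a function of the conserved
quantities: `Σᵢ |vᵢ − u|² = 2·E(z) − 2⟪P(z), u⟫ + (N+1)|u|²`. [folklore] -/
theorem sum_norm_vel_sub_sq {N : ℕ} (z : Config (N + 1) (Fin 3) T3) (u : V3) :
    ∑ i, ‖(z i).2 - u‖ ^ 2 =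
      2 * configEnergy z - 2 * ⟪configMomentum z, u⟫_ℝ + ((N : ℝ) + 1) * ‖u‖ ^ 2 := by
  simp only [configEnergy, configMomentum, sum_inner, Finset.mul_sum, ← Finset.sum_sub_distrib]
  have hcard : ((N : ℝ) + 1) * ‖u‖ ^ 2 = ∑ _i : Fin (N + 1), ‖u‖ ^ 2 := by
    simp [Finset.sum_const, Finset.card_univ, Fintype.card_fin]
  rw [hcard, ← Finset.sum_add_distrib]
  refine Finset.sum_congr rfl fun i _ => ?_
  rw [norm_sub_sq_real]
  ring

/-- Closed form of the tensor power of a constant-profile local Gibbs profile: a constant times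
`exp(−Σᵢ|vᵢ − u|²/(2θ))`. [folklore] -/
theorem tensorPow_localGibbsProfile_const {N : ℕ} (c θ : ℝ) (u : V3) (z : Config (N + 1) (Fin 3) T3) :
    tensorPow (N + 1) (localGibbsProfile (fun _ => c) (fun _ => u) (fun _ => θ)) z =
      (c * (2 * Real.pi * θ) ^ (-(Module.finrank ℝ V3 : ℝ) / 2)) ^ (N + 1) *
        Real.exp (-(∑ i, ‖(z i).2 - u‖ ^ 2) / (2 * θ)) := by
  simp only [tensorPow, localGibbsProfile, localMaxwellian, one_mul]
  rw [show (fun i : Fin (N + 1) => c * ((2 * Real.pi * θ) ^ (-(Module.finrank ℝ V3 : ℝ) / 2) *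
      Real.exp (-‖(z i).2 - u‖ ^ 2 / (2 * θ)))) = fun i =>
      (c * (2 * Real.pi * θ) ^ (-(Module.finrank ℝ V3 : ℝ) / 2)) * Real.exp (-‖(z i).2 - u‖ ^ 2 / (2 * θ))
      from funext fun i => by ring]
  rw [Finset.prod_mul_distrib, Finset.prod_const, Finset.card_univ, Fintype.card_fin, ← Real.exp_sum]
  congr 2
  rw [← Finset.sum_neg_distrib, Finset.sum_div]

/-- **The constant-profile local Gibbs weight is invariant along every hard-sphere flow on its good set**
(energy and momentum conservation: `HardSphereFlow.configEnergy_flow`, `HardSphereFlow.configMomentum_flow`).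
[folklore] -/
theorem tensorPow_localGibbsProfile_const_flow {σ : ℝ} (c θ : ℝ) (u : V3) {N : ℕ}
    (Φ : HardSphereFlow (Torus.geometry (Fin 3)) (hsDiameter σ N) (N + 1))
    {z : Config (N + 1) (Fin 3) T3} (hz : z ∈ Φ.good) (t : ℝ) :
    tensorPow (N + 1) (localGibbsProfile (fun _ => c) (fun _ => u) (fun _ => θ)) (Φ.flow t z) =
      tensorPow (N + 1) (localGibbsProfile (fun _ => c) (fun _ => u) (fun _ => θ)) z := by
  rw [tensorPow_localGibbsProfile_const, tensorPow_localGibbsProfile_const, sum_norm_vel_sub_sq,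
    sum_norm_vel_sub_sq, Φ.configEnergy_flow hz t, Φ.configMomentum_flow hz t]

/-- The canonical density of a constant-profile local Gibbs state is invariant along every hard-sphere flow on
its good set. [folklore] -/
theorem canonicalDensity_const_flow {σ : ℝ} (c θ : ℝ) (u : V3) {N : ℕ}
    (Φ : HardSphereFlow (Torus.geometry (Fin 3)) (hsDiameter σ N) (N + 1))
    {z : Config (N + 1) (Fin 3) T3} (hz : z ∈ Φ.good) (t : ℝ) :
    canonicalDensity (Torus.geometry (Fin 3)) (hsDiameter σ N) (N + 1)
        (localGibbsProfile (fun _ => c) (fun _ => u) (fun _ => θ)) (Φ.flow t z) =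
      canonicalDensity (Torus.geometry (Fin 3)) (hsDiameter σ N) (N + 1)
        (localGibbsProfile (fun _ => c) (fun _ => u) (fun _ => θ)) z := by
  simp only [canonicalDensity]
  rw [Set.indicator_of_mem (Φ.good_subset (Φ.mapsTo_good t hz)),
    Set.indicator_of_mem (Φ.good_subset hz), tensorPow_localGibbsProfile_const_flow c θ u Φ hz t]

/-- **Core invariance lemma** (no positivity hypotheses): the push-forward of the constant-profile local Gibbs law
under `Φ_t` is itself — Liouville's theorem (`HardSphereFlow.measurePreserving`) plus invariance of the density on
the conull good set (energy and momentum conservation). [folklore] -/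
theorem map_flow_localGibbsLaw_const {σ : ℝ} (c θc : ℝ) (uc : V3) {N : ℕ}
    (Φ : HardSphereFlow (Torus.geometry (Fin 3)) (hsDiameter σ N) (N + 1)) (t : ℝ) :
    (localGibbsLaw σ (fun _ => c) (fun _ => uc) (fun _ => θc) N Φ).map (Φ.flow t) =
      localGibbsLaw σ (fun _ => c) (fun _ => uc) (fun _ => θc) N Φ := by
  set L := liouville (Torus.geometry (Fin 3)) (N + 1) (hsDiameter σ N) with hL
  set ρ : Config (N + 1) (Fin 3) T3 → ENNReal := fun z => ENNReal.ofReal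
    (canonicalDensity (Torus.geometry (Fin 3)) (hsDiameter σ N) (N + 1)
      (localGibbsProfile (fun _ => c) (fun _ => uc) (fun _ => θc)) z) with hρ
  have hG : localGibbsLaw σ (fun _ => c) (fun _ => uc) (fun _ => θc) N Φ = L.withDensity ρ := by
    simp only [localGibbsLaw, particleLaw_eq, hL, hρ]
  have hρm : Measurable ρ :=
    (measurable_canonicalDensity (hsDiameter σ N) (N + 1)
      (measurable_localGibbsProfile continuous_const continuous_const continuous_const)).ennreal_ofReal
  rw [hG]
  ext A hA
  rw [Measure.map_apply (Φ.measurable_flow t) hA, withDensity_apply _ (hA.preimage (Φ.measurable_flow t)),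
    withDensity_apply _ hA, ← lintegral_indicator (hA.preimage (Φ.measurable_flow t)),
    ← lintegral_indicator hA]
  have key : (fun z => (Φ.flow t ⁻¹' A).indicator ρ z) =ᵐ[L] fun z => (A.indicator ρ) (Φ.flow t z) := by
    filter_upwards [Φ.ae_mem_good] with z hz
    by_cases h : Φ.flow t z ∈ A
    · rw [Set.indicator_of_mem h, Set.indicator_of_mem (show z ∈ Φ.flow t ⁻¹' A from h), hρ]
      simp only []
      rw [canonicalDensity_const_flow c θc uc Φ hz t]
    · rw [Set.indicator_of_notMem h, Set.indicator_of_notMem (show z ∉ Φ.flow t ⁻¹' A from h)]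
  rw [lintegral_congr_ae key]
  exact (Φ.measurePreserving t).lintegral_comp (hρm.indicator hA)

/-- Consequence used by every dynamical lemma: `Φ_t` PRESERVES the constant-profile local Gibbs law. [folklore] -/
theorem measurePreserving_flow_localGibbsLaw {σ : ℝ} (c θ : ℝ) (u : V3) {N : ℕ}
    (Φ : HardSphereFlow (Torus.geometry (Fin 3)) (hsDiameter σ N) (N + 1)) (t : ℝ) :
    MeasurePreserving (Φ.flow t) (localGibbsLaw σ (fun _ => c) (fun _ => u) (fun _ => θ) N Φ)
      (localGibbsLaw σ (fun _ => c) (fun _ => u) (fun _ => θ) N Φ) :=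
  ⟨Φ.measurable_flow t, map_flow_localGibbsLaw_const c θ u Φ t⟩


end BoltzmannGreenKuboOrthMomentum

end Summit.AtomisticToContinuum.HydrodynamicLimit.Theorems

end
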